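import Summits.Ventures.DiscreteObjects.Hadamard.Order334InvertingFixedWilliamson668
import Summits.Ventures.DiscreteObjects.Hadamard.Order334ItoTfae668

/-!
# H(668): what a negative answer on the Ito / Williamson side would exclude (conditional exclusions, kernel)

Framing: lottery ticket; floor = certified bounds/negative ranges.

Cell pub-namedobj (venture DiscreteObjects), target (H), hadamard gen 23.  The contrapositive reading of the order-334 dictionary
(`Order334ItoTfae668`, `Order334InvertingFixedWilliamson668`) — the census lines a future NEGATIVE search result would buy:
* **`hadamard668_no_order334_of_no_itoQuadruple`**: if NO Ito-type (quasi-Williamson) quadruple of order 167 exists, then NO Hadamard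
  matrix of order 668 has a signed automorphism of pair order 334; **`hadamard668_no_centralizing_involution_of_no_itoQuadruple`**:
  … and no element of order 167 of any H(668) commutes with a non-trivial involution pair (every `C(σ₁₆₇)/±⟨σ₁₆₇⟩` is trivial);
  **`hadamard668_no_order334_of_no_negaPair`**: the same conclusions from 'no negaperiodic Golay pair of length 334'.
* **`hadamard668_no_inverting_fixed_of_no_williamsonSequences`**: if NO Williamson sequences of length 167 exist, then no H(668) has
  an element of pair order 334 inverted by an automorphism fixing a row; **`hadamard668_no_index_eight_of_no_williamsonSequences`**:
  … and no H(668) realises the `|N(⟨σ₁₆₇⟩):±⟨σ₁₆₇⟩| = 8` configuration (gen 22).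
No hypothesis here is known to hold (Ito's conjecture at 167 and Williamson-167 are OPEN; Williamson sequences are enumerated in print
only for odd lengths ≤ 59/63, NG-pairs listed only to length ≤ 238); these are CONDITIONAL exclusions, recorded so that the table can
quote exactly what a certified negative would imply.  No order excluded; H(668) untouched.  Ours; no `sorry`, no definitions.
-/

namespace Summit.Ventures.DiscreteObjects.Hadamard

open Finset BigOperators Matrix

open Literature.Combinatorics.Designs.GoethalsSeidel (IsHadamardMatrix circT)
open Literature.Combinatorics.Designs.LegendrePairs (PAF IsPM)
open Literature.Combinatorics.Designs.ItoArray (itoMatrix)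

/-- **No Ito-type quadruple of order 167 ⇒ no H(668) has an automorphism of pair order 334.** -/
theorem hadamard668_no_order334_of_no_itoQuadruple (hno : ¬ ∃ a b c d : ZMod 167 → ℤ, IsHadamardMatrix (itoMatrix a b c d)) :
    ¬ ∃ (ι : Type) (_ : Fintype ι) (_ : DecidableEq ι) (H : Matrix ι ι ℤ) (π κ : Equiv.Perm ι) (d e : ι → ℤ),
      Fintype.card ι = 668 ∧ IsHadamardMatrix H ∧ IsSignedAut H π κ d e ∧
      orderOf ((π, κ) : Equiv.Perm ι × Equiv.Perm ι) = 334 :=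
  fun h => hno (hadamard668_order334_iff_itoMatrix.mp h)

/-- **No Ito-type quadruple of order 167 ⇒ no element of order 167 of any H(668) commutes with a non-trivial involution pair**
(the centraliser quotient `C(σ)/±⟨σ⟩` is trivial for every `σ` of order 167). -/
theorem hadamard668_no_centralizing_involution_of_no_itoQuadruple
    (hno : ¬ ∃ a b c d : ZMod 167 → ℤ, IsHadamardMatrix (itoMatrix a b c d)) :
    ¬ ∃ (ι : Type) (_ : Fintype ι) (_ : DecidableEq ι) (H : Matrix ι ι ℤ) (π κ π₁ κ₁ : Equiv.Perm ι) (d e d₁ e₁ : ι → ℤ),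
      Fintype.card ι = 668 ∧ IsHadamardMatrix H ∧ IsSignedAut H π κ d e ∧ π ^ 167 = 1 ∧ κ ^ 167 = 1 ∧ (π ≠ 1 ∨ κ ≠ 1) ∧
      IsSignedAut H π₁ κ₁ d₁ e₁ ∧ Commute π₁ π ∧ Commute κ₁ κ ∧ π₁ ^ 2 = 1 ∧ κ₁ ^ 2 = 1 ∧ (π₁ ≠ 1 ∨ κ₁ ≠ 1) :=
  fun h => hno (hadamard668_centralizer167_index_two_iff_itoMatrix.mp h)

/-- **No negaperiodic Golay pair of length 334 ⇒ no H(668) has an automorphism of pair order 334** (and hence, by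
`Order668Excluded`-type facts, none of order 668 either; here only the order-334 statement). -/
theorem hadamard668_no_order334_of_no_negaPair
    (hno : ¬ ∃ u v : ZMod 668 → ℤ, IsPM u ∧ IsPM v ∧ (∀ x, u (x + 334) = -u x) ∧ (∀ x, v (x + 334) = -v x) ∧
      ∀ s : ZMod 668, s ≠ 0 → s ≠ 334 → PAF u s + PAF v s = 0) :
    ¬ ∃ (ι : Type) (_ : Fintype ι) (_ : DecidableEq ι) (H : Matrix ι ι ℤ) (π κ : Equiv.Perm ι) (d e : ι → ℤ),
      Fintype.card ι = 668 ∧ IsHadamardMatrix H ∧ IsSignedAut H π κ d e ∧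
      orderOf ((π, κ) : Equiv.Perm ι × Equiv.Perm ι) = 334 :=
  fun h => hno ((hadamard668_order334_tfae.out 0 2).mp h)

/-- **No Williamson sequences of length 167 ⇒ no H(668) has an element of pair order 334 inverted by a row-fixing automorphism.** -/
theorem hadamard668_no_inverting_fixed_of_no_williamsonSequences
    (hno : ¬ ∃ a b c d : ZMod 167 → ℤ, IsPM a ∧ IsPM b ∧ IsPM c ∧ IsPM d ∧ (∀ i, a (-i) = a i) ∧ (∀ i, b (-i) = b i) ∧
      (∀ i, c (-i) = c i) ∧ (∀ i, d (-i) = d i) ∧ ∀ s : ZMod 167, s ≠ 0 → PAF a s + PAF b s + PAF c s + PAF d s = 0) :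
    ¬ ∃ (ι : Type) (_ : Fintype ι) (_ : DecidableEq ι) (H : Matrix ι ι ℤ) (π κ π' κ' : Equiv.Perm ι)
        (d e d' e' : ι → ℤ) (ν : ℕ) (x₀ : ι), Fintype.card ι = 668 ∧ IsHadamardMatrix H ∧ IsSignedAut H π κ d e ∧
        orderOf ((π, κ) : Equiv.Perm ι × Equiv.Perm ι) = 334 ∧ IsSignedAut H π' κ' d' e' ∧
        π' * π = π ^ ν * π' ∧ κ' * κ = κ ^ ν * κ' ∧ ν % 334 = 333 ∧ π' x₀ = x₀ :=
  fun h => hno (hadamard668_order334_inverting_fixed_iff_williamsonSequences.mp h)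

/-- **No Williamson sequences of length 167 ⇒ no H(668) realises `|N(⟨σ₁₆₇⟩):±⟨σ₁₆₇⟩| = 8`** (gen 22's configuration: σ of order
167 with an index-4 centraliser and an inverting automorphism). -/
theorem hadamard668_no_index_eight_of_no_williamsonSequences
    (hno : ¬ ∃ a b c d : ZMod 167 → ℤ, IsPM a ∧ IsPM b ∧ IsPM c ∧ IsPM d ∧ (∀ i, a (-i) = a i) ∧ (∀ i, b (-i) = b i) ∧
      (∀ i, c (-i) = c i) ∧ (∀ i, d (-i) = d i) ∧ ∀ s : ZMod 167, s ≠ 0 → PAF a s + PAF b s + PAF c s + PAF d s = 0) :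
    ¬ ∃ (ι : Type) (_ : Fintype ι) (_ : DecidableEq ι) (H : Matrix ι ι ℤ) (π κ π₁ κ₁ π₂ κ₂ π' κ' : Equiv.Perm ι)
        (d e d₁ e₁ d₂ e₂ d' e' : ι → ℤ) (μ : ℕ), Fintype.card ι = 668 ∧ IsHadamardMatrix H ∧ IsSignedAut H π κ d e ∧
        π ^ 167 = 1 ∧ κ ^ 167 = 1 ∧ (π ≠ 1 ∨ κ ≠ 1) ∧ IsSignedAut H π₁ κ₁ d₁ e₁ ∧ IsSignedAut H π₂ κ₂ d₂ e₂ ∧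
        Commute π₁ π ∧ Commute κ₁ κ ∧ Commute π₂ π ∧ Commute κ₂ κ ∧ π₁ ^ 2 = 1 ∧ κ₁ ^ 2 = 1 ∧ π₂ ^ 2 = 1 ∧ κ₂ ^ 2 = 1 ∧
        (π₁ ≠ 1 ∨ κ₁ ≠ 1) ∧ (π₂ ≠ 1 ∨ κ₂ ≠ 1) ∧ (π₁ ≠ π₂ ∨ κ₁ ≠ κ₂) ∧ IsSignedAut H π' κ' d' e' ∧
        π' * π = π ^ μ * π' ∧ κ' * κ = κ ^ μ * κ' ∧ μ % 167 = 166 :=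
  fun h => hno (hadamard668_normalizer_index_eight_iff_williamsonSequences.mp h)

end Summit.Ventures.DiscreteObjects.Hadamard
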